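import Literature.NumberTheory.Congruences.JacobsthalWeakBlockCongruence
import Mathlib.NumberTheory.Padics.PadicVal.Basic
import Mathlib.Tactic
import HarnessLib

/-!
# The weak block polynomial congruences: `∏_{0<i<cp, p∤i} (px + i) ≡ ∏ i (mod p^{e+v_p(c)} · x(x+c) ℤ[x])`, `e = 2` (odd `p`), `e = 1` (`p = 2`, `c` even)

Topic `Literature/NumberTheory/Congruences`, namespace `Literature.NumberTheory.Congruences.JacobsthalWeak`;
the sequel of `JacobsthalWeakBlockCongruence.lean` (which holds the sources, quoted verbatim, and the route)
and the input of `JacobsthalWeakBinomialCongruence.lean`. Everything here is PROVED (theorems only; no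
definitions, no named facts). HONEST FRAMING (cell pub-zeta5, D2 lens): classical binomial-coefficient
congruences at `p = 2, 3`; nothing about `ζ(5)`.

With `E_c(x) = ∏_{k<c} ∏_{0<i<p} (px + kp + i) = ∏_{0<i<cp, p∤i} (px + i)` (so that `C(ap, bp) · E_{a−b}(0) =
C(a, b) · E_{a−b}(b)`, the exact identity of the binomial file):

* `eval_neg_blocks_eq` — the reflection `i ↦ cp − i`: `E_c(−c) = (−1)^{(p−1)c} E_c(0)` (any prime; the sign is `+1`
  unless `p = 2` and `c` is odd — the source of the sign `ε` in [Straub2014] (41) at `p = 2`);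
* `C_dvd_blocks_sub_C_eval_zero` — `E_c(x) − E_c(0) ∈ p · x ℤ[x]` coefficientwise (every `x` carries a `p`);
* `exists_blocks_eq_odd` — odd `p`: `E_c(x) = E_c(0) + p^{2+v_p(c)} · x (x + c) · H(x)`, `H ∈ ℤ[x]`;
* `exists_blocks_eq_two` — `p = 2`, `c` even: `E_c(x) = E_c(0) + 2^{1+v_2(c)} · x (x + c) · H(x)`.

Route: as in the tree's `JacobsthalBlockPolynomial.lean` (`p ≥ 5`, exponent `3 + v_p(c)`): `c = p^s u`; the `u`
translates `x ↦ x + w p^s` of the one-block congruence modulo `p^{s+1+e'}` (`e' = 1` odd / `0` two, previous file)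
make `E_c − E_c(0)` divisible by `p^{s+1+e'}` coefficientwise; `x = 0` and `x = −c` are roots and `x(x+c)` is monic.
References: [Straub2014] Lemma 5.1 (41) (incl. `p = 2, 3`); [OsburnSahuStraub2016] §2 (proof of Theorem 1.3);
[Mestrovic2011] §6 (34). Adapted from the tree's `JacobsthalBlockPolynomial.lean` (denom-engine-d2 g47), whose
private helpers are re-proved here.
-/

noncomputable section

open Polynomial Finset
open scoped Nat

namespace Literature.NumberTheory.Congruences.JacobsthalWeak

section Blocks

variable {p : ℕ} [hp : Fact p.Prime]

omit hp in
/-- Reduction modulo `n` kills an integer polynomial iff `n` divides it coefficientwise. [folklore] -/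
private theorem map_eq_zero_iff_C_dvd (n : ℕ) (P : ℤ[X]) :
    P.map (Int.castRingHom (ZMod n)) = 0 ↔ C (n : ℤ) ∣ P := by
  -- adapted from the tree's `Jacobsthal.map_eq_zero_iff_C_dvd` (private there)
  rw [C_dvd_iff_dvd_coeff, Polynomial.ext_iff]
  refine forall_congr' fun i => ?_
  rw [coeff_map, coeff_zero, eq_intCast, ZMod.intCast_zmod_eq_zero_iff_dvd]

omit hp in
/-- If `X (X + c) H` is coefficientwise divisible by `n`, so is `H` (the quadratic is monic). [folklore] -/
private theorem C_dvd_of_C_dvd_X_mul (n : ℕ) (c : ℤ) (H : ℤ[X]) (h : C (n : ℤ) ∣ X * (X + C c) * H) :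
    C (n : ℤ) ∣ H := by
  -- adapted from the tree's `Jacobsthal.C_dvd_of_C_dvd_X_mul` (private there)
  rw [← map_eq_zero_iff_C_dvd] at h ⊢
  rw [Polynomial.map_mul, Polynomial.map_mul, map_X, Polynomial.map_add, map_X, map_C] at h
  have hmon : ((X : (ZMod n)[X]) * (X + C ((Int.castRingHom (ZMod n)) c))).Monic :=
    monic_X.mul (monic_X_add_C _)
  exact hmon.mul_right_eq_zero_iff.mp h

omit hp in
/-- Reflection of the inner block: `∏_{0<i<p} g(p − i) = ∏_{0<i<p} g(i)`. [folklore] -/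
private theorem prod_Icc_reflect {M : Type*} [CommMonoid M] (g : ℕ → M) :
    ∏ i ∈ Icc 1 (p - 1), g (p - i) = ∏ i ∈ Icc 1 (p - 1), g i := by
  -- adapted from the tree's `Jacobsthal.prod_Icc_reflect` (private there)
  refine prod_nbij' (fun i => p - i) (fun i => p - i) (fun i hi => ?_) (fun i hi => ?_)
    (fun i hi => ?_) (fun i hi => ?_) (fun i _ => rfl)
  all_goals simp only [mem_Icc] at hi ⊢; omega

/-- `t(p^{s+1})` is the set of the numbers `k p + i` with `k < p^s` and `0 < i < p`, so that a product over
`t(p^{s+1})` is a double product over blocks. [folklore] -/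
private theorem prod_coprime_pow_succ_eq {M : Type*} [CommMonoid M] (s : ℕ) (g : ℕ → M) :
    ∏ t ∈ {t ∈ range (p ^ (s + 1)) | (p ^ (s + 1)).Coprime t}, g t =
      ∏ k ∈ range (p ^ s), ∏ i ∈ Icc 1 (p - 1), g (k * p + i) := by
  -- adapted from the tree's `Jacobsthal.prod_coprime_pow_succ_eq` (private there)
  have hp' := hp.out
  have hset : {t ∈ range (p ^ (s + 1)) | (p ^ (s + 1)).Coprime t} =
      (range (p ^ s) ×ˢ Icc 1 (p - 1)).image (fun q : ℕ × ℕ => q.1 * p + q.2) := by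
    ext t
    simp only [mem_filter, mem_range, mem_image, mem_product, mem_Icc, Prod.exists,
      Nat.coprime_pow_left_iff (Nat.succ_pos s), hp'.coprime_iff_not_dvd]
    constructor
    · rintro ⟨ht, hndvd⟩
      refine ⟨t / p, t % p, ⟨?_, ?_, ?_⟩, Nat.div_add_mod' t p⟩
      · exact (Nat.div_lt_iff_lt_mul hp'.pos).mpr (by rwa [← pow_succ])
      · exact Nat.one_le_iff_ne_zero.mpr fun h => hndvd (Nat.dvd_of_mod_eq_zero h)
      · have := Nat.mod_lt t hp'.pos; omega
    · rintro ⟨k, i, ⟨hk, hi1, hi2⟩, rfl⟩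
      refine ⟨?_, fun h => ?_⟩
      · have h1 : k * p + p ≤ p ^ s * p := by
          have := Nat.mul_le_mul_right p hk
          rwa [Nat.succ_mul] at this
        rw [pow_succ]; omega
      · have hi : p ∣ i := (Nat.dvd_add_right (dvd_mul_left p k)).mp h
        have := Nat.le_of_dvd (by omega) hi
        omega
  have hinj : Set.InjOn (fun q : ℕ × ℕ => q.1 * p + q.2) ↑(range (p ^ s) ×ˢ Icc 1 (p - 1)) := by
    rintro ⟨k, i⟩ hq ⟨k', i'⟩ hq' h
    simp only [coe_product, Set.mem_prod, mem_coe, mem_range, mem_Icc] at hq hq'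
    simp only at h
    have hi : i = i' := by
      have h1 := congrArg (· % p) h
      simp only [Nat.mul_add_mod_of_lt (show i < p by omega),
        Nat.mul_add_mod_of_lt (show i' < p by omega)] at h1
      exact h1
    subst hi
    have hk : k * p = k' * p := by omega
    exact Prod.ext (Nat.eq_of_mul_eq_mul_right hp'.pos hk) rfl
  rw [hset, prod_image hinj, prod_product]

omit hp in
/-- The constant term of a block product: `E_c(0) = ∏_{k<c} ∏_{0<i<p} (k p + i)` (the denominator of the ratio
`C(ap,bp)/C(a,b) = E_{a−b}(b)/E_{a−b}(0)` in (41)). [cite: Straub2014, Lemma 5.1 (41) (proof mechanism)] -/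
theorem eval_zero_blocks (c : ℕ) :
    (∏ k ∈ range c, ∏ i ∈ Icc 1 (p - 1), (C (p : ℤ) * X + C ((k * p + i : ℕ) : ℤ))).eval 0 =
      ∏ k ∈ range c, ∏ i ∈ Icc 1 (p - 1), ((k * p + i : ℕ) : ℤ) := by
  -- adapted from the tree's `Jacobsthal.eval_zero_blocks` (private there)
  rw [eval_prod]
  refine prod_congr rfl fun k _ => ?_
  rw [eval_prod]
  refine prod_congr rfl fun i _ => ?_
  simp

/-- **The reflection `i ↦ cp − i`** of `{0 < i < cp : p ∤ i}`, with its sign: `E_c(−c) = (−1)^{(p−1)c} E_c(0)`,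
i.e. `∏_{k<c} ∏_{0<i<p} (−cp + kp + i) = (−1)^{(p−1)c} ∏∏ (kp + i)` (every prime `p`; the sign is `+1` unless `p = 2`
and `c` is odd, which is where `ε = −1` of [Straub2014] (41) comes from). [cite: Straub2014, Lemma 5.1 (41)] -/
theorem eval_neg_blocks_eq (c : ℕ) :
    (∏ k ∈ range c, ∏ i ∈ Icc 1 (p - 1), (C (p : ℤ) * X + C ((k * p + i : ℕ) : ℤ))).eval (-(c : ℤ)) =
      (-1) ^ ((p - 1) * c) * ∏ k ∈ range c, ∏ i ∈ Icc 1 (p - 1), ((k * p + i : ℕ) : ℤ) := by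
  -- adapted from the tree's `Jacobsthal.eval_neg_blocks` (p odd, private there)
  have hp' := hp.out
  rw [eval_prod]
  -- each block at `−c` is `(−1)^{p−1}` times a reflected block
  have hblock : ∀ k ∈ range c,
      (∏ i ∈ Icc 1 (p - 1), (C (p : ℤ) * X + C ((k * p + i : ℕ) : ℤ))).eval (-(c : ℤ)) =
        (-1) ^ (p - 1) * ∏ i ∈ Icc 1 (p - 1), (((c - 1 - k) * p + (p - i) : ℕ) : ℤ) := by
    intro k hk
    have hk' := mem_range.mp hk
    have hterm : ∀ i ∈ Icc 1 (p - 1), (C (p : ℤ) * X + C ((k * p + i : ℕ) : ℤ)).eval (-(c : ℤ)) =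
        (-1) * (((c - 1 - k) * p + (p - i) : ℕ) : ℤ) := by
      intro i hi
      have hi' := mem_Icc.mp hi
      have e1 : ((c - 1 - k : ℕ) : ℤ) = (c : ℤ) - 1 - k := by
        rw [Nat.cast_sub (by omega : k ≤ c - 1), Nat.cast_sub (by omega : 1 ≤ c), Nat.cast_one]
      have e2 : ((p - i : ℕ) : ℤ) = (p : ℤ) - i := by rw [Nat.cast_sub (by omega : i ≤ p)]
      simp only [eval_add, eval_mul, eval_C, eval_X, Nat.cast_add, Nat.cast_mul, e1, e2]
      ring
    rw [eval_prod, prod_congr rfl hterm, prod_mul_distrib, prod_const, Nat.card_Icc,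
      show p - 1 + 1 - 1 = p - 1 by omega]
  rw [prod_congr rfl hblock, prod_mul_distrib, prod_const, card_range, ← pow_mul]
  congr 1
  have hrefl := prod_range_reflect (fun k' => ∏ i ∈ Icc 1 (p - 1), ((k' * p + (p - i) : ℕ) : ℤ)) c
  rw [hrefl]
  refine prod_congr rfl fun k _ => ?_
  exact prod_Icc_reflect (fun i => ((k * p + i : ℕ) : ℤ))

omit hp in
/-- Every `x` in `E_c(x)` carries a factor `p`: `E_c(x) − E_c(0) ∈ p ℤ[x]` coefficientwise (used for the odd-`c`
cases of (41) at `p = 2`). [cite: Straub2014, Lemma 5.1 (41) (proof mechanism, p = 2)] -/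
theorem C_dvd_blocks_sub_C_eval_zero (c : ℕ) :
    C (p : ℤ) ∣ ∏ k ∈ range c, ∏ i ∈ Icc 1 (p - 1), (C (p : ℤ) * X + C ((k * p + i : ℕ) : ℤ)) -
      C (∏ k ∈ range c, ∏ i ∈ Icc 1 (p - 1), ((k * p + i : ℕ) : ℤ)) := by
  set G : ℤ[X] := ∏ k ∈ range c, ∏ i ∈ Icc 1 (p - 1), (X + C ((k * p + i : ℕ) : ℤ)) with hG
  have hcomp : ∏ k ∈ range c, ∏ i ∈ Icc 1 (p - 1), (C (p : ℤ) * X + C ((k * p + i : ℕ) : ℤ)) =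
      G.comp (C (p : ℤ) * X) := by
    rw [hG, Polynomial.prod_comp]
    refine prod_congr rfl fun k _ => ?_
    rw [Polynomial.prod_comp]
    refine prod_congr rfl fun i _ => ?_
    rw [add_comp, X_comp, C_comp]
  have h0 : ∏ k ∈ range c, ∏ i ∈ Icc 1 (p - 1), ((k * p + i : ℕ) : ℤ) = (G.comp (C (p : ℤ) * X)).coeff 0 := by
    rw [← hcomp, coeff_zero_eq_eval_zero, eval_zero_blocks]
  rw [hcomp, h0, C_dvd_iff_dvd_coeff]
  intro i
  rw [coeff_sub, coeff_C]
  rcases Nat.eq_zero_or_pos i with h | h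
  · subst h; simp
  · rw [if_neg (by omega), sub_zero]
    -- `[X^i] G(pX) = p^i [X^i] G`
    have hc : (G.comp (C (p : ℤ) * X)).coeff i = (p : ℤ) ^ i * G.coeff i := by
      clear h0 hcomp
      induction G using Polynomial.induction_on' with
      | add f g hf hg => rw [add_comp, coeff_add, coeff_add, hf, hg, mul_add]
      | monomial n a =>
        rw [← C_mul_X_pow_eq_monomial, mul_comp, C_comp, X_pow_comp, mul_pow, ← C_pow, ← mul_assoc,
          ← C_mul, coeff_C_mul_X_pow, coeff_C_mul_X_pow]
        split_ifs with h'
        · subst h'; ring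
        · rw [mul_zero]
    rw [hc]
    exact ⟨(p : ℤ) ^ (i - 1) * G.coeff i, by rw [← mul_assoc, ← pow_succ', Nat.sub_add_cancel h]⟩

/-- **Several blocks modulo `p^{s+1+e}`** from a one-block congruence with that modulus: the reduction of
`E_{p^s u}(x)` modulo `p^{s+1+e}` is a constant polynomial (the `u` translates `x ↦ x + w p^s`). [folklore] -/
private theorem exists_map_blocks_eq_C (s e : ℕ)
    (hone : ∃ H : ℤ[X], ∏ t ∈ {t ∈ range (p ^ (s + 1)) | (p ^ (s + 1)).Coprime t}, (C (p : ℤ) * X + C (t : ℤ)) =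
      C (∏ t ∈ {t ∈ range (p ^ (s + 1)) | (p ^ (s + 1)).Coprime t}, (t : ℤ)) + C ((p : ℤ) ^ (s + 1 + e)) * H)
    (u : ℕ) :
    ∃ c₀ : ZMod (p ^ (s + 1 + e)), (∏ k ∈ range (p ^ s * u), ∏ i ∈ Icc 1 (p - 1),
      (C (p : ℤ) * X + C ((k * p + i : ℕ) : ℤ))).map (Int.castRingHom (ZMod (p ^ (s + 1 + e)))) = C c₀ := by
  -- adapted from the tree's `Jacobsthal.exists_map_blocks_eq_C` (p ≥ 5, e = 2, private there)
  obtain ⟨H, hH⟩ := hone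
  rw [prod_coprime_pow_succ_eq, prod_coprime_pow_succ_eq] at hH
  set B : ℤ[X] := ∏ k ∈ range (p ^ s), ∏ i ∈ Icc 1 (p - 1), (C (p : ℤ) * X + C ((k * p + i : ℕ) : ℤ))
    with hB
  set ψ := Int.castRingHom (ZMod (p ^ (s + 1 + e))) with hψ
  have hBmap : B.map ψ = C (ψ (∏ k ∈ range (p ^ s), ∏ i ∈ Icc 1 (p - 1), ((k * p + i : ℕ) : ℤ))) := by
    have h0 : ψ ((p : ℤ) ^ (s + 1 + e)) = 0 := by
      rw [map_pow, map_natCast, ← Nat.cast_pow, ZMod.natCast_self]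
    rw [hH, Polynomial.map_add, Polynomial.map_mul, map_C, map_C, h0, C_0, zero_mul, add_zero]
  induction u with
  | zero => exact ⟨1, by simp⟩
  | succ u ih =>
    obtain ⟨c₀, hc₀⟩ := ih
    refine ⟨c₀ * ψ (∏ k ∈ range (p ^ s), ∏ i ∈ Icc 1 (p - 1), ((k * p + i : ℕ) : ℤ)), ?_⟩
    rw [Nat.mul_succ, prod_range_add, Polynomial.map_mul, hc₀, C_mul]
    congr 1
    have hshift : ∏ k ∈ range (p ^ s), ∏ i ∈ Icc 1 (p - 1),
        (C (p : ℤ) * X + C (((p ^ s * u + k) * p + i : ℕ) : ℤ)) = B.comp (X + C ((p ^ s * u : ℕ) : ℤ)) := by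
      rw [hB, Polynomial.prod_comp]
      refine prod_congr rfl fun k _ => ?_
      rw [Polynomial.prod_comp]
      refine prod_congr rfl fun i _ => ?_
      rw [add_comp, mul_comp, C_comp, X_comp, C_comp]
      simp only [Nat.cast_add, Nat.cast_mul, Nat.cast_pow, C_add, C_mul, C_pow]
      ring
    rw [hshift, Polynomial.map_comp, hBmap, C_comp]

/-- The same, pulled back to `ℤ[x]`: `p^{s+1+e}` divides `E_{p^s u}(x)` minus its constant term, coefficientwise.
[folklore] -/
private theorem C_pow_dvd_blocks_sub_C (s e : ℕ)
    (hone : ∃ H : ℤ[X], ∏ t ∈ {t ∈ range (p ^ (s + 1)) | (p ^ (s + 1)).Coprime t}, (C (p : ℤ) * X + C (t : ℤ)) =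
      C (∏ t ∈ {t ∈ range (p ^ (s + 1)) | (p ^ (s + 1)).Coprime t}, (t : ℤ)) + C ((p : ℤ) ^ (s + 1 + e)) * H)
    (u : ℕ) :
    C ((p : ℤ) ^ (s + 1 + e)) ∣ ∏ k ∈ range (p ^ s * u), ∏ i ∈ Icc 1 (p - 1),
        (C (p : ℤ) * X + C ((k * p + i : ℕ) : ℤ)) -
      C (∏ k ∈ range (p ^ s * u), ∏ i ∈ Icc 1 (p - 1), ((k * p + i : ℕ) : ℤ)) := by
  -- adapted from the tree's `Jacobsthal.C_dvd_blocks_sub_C` (private there)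
  obtain ⟨c₀, hc₀⟩ := exists_map_blocks_eq_C (p := p) s e hone u
  have h := map_eq_zero_iff_C_dvd (p ^ (s + 1 + e)) (∏ k ∈ range (p ^ s * u), ∏ i ∈ Icc 1 (p - 1),
        (C (p : ℤ) * X + C ((k * p + i : ℕ) : ℤ)) -
      C (∏ k ∈ range (p ^ s * u), ∏ i ∈ Icc 1 (p - 1), ((k * p + i : ℕ) : ℤ)))
  rw [Nat.cast_pow] at h
  rw [← h, Polynomial.map_sub, hc₀, map_C, ← eval_zero_blocks, ← coeff_zero_eq_eval_zero, sub_eq_zero,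
    ← coeff_map, hc₀, coeff_C_zero]

omit hp in
/-- **From a coefficientwise congruence to the two roots**: if `E_c(x) − E_c(0) ∈ p^M ℤ[x]` and `E_c(−c) = E_c(0)`
with `c > 0`, then `E_c(x) = E_c(0) + p^M x (x + c) H(x)`. [folklore] -/
private theorem exists_blocks_eq_of_dvd {c : ℕ} (hc : 0 < c) (M : ℕ)
    (hdvd : C ((p : ℤ) ^ M) ∣ ∏ k ∈ range c, ∏ i ∈ Icc 1 (p - 1), (C (p : ℤ) * X + C ((k * p + i : ℕ) : ℤ)) -
      C (∏ k ∈ range c, ∏ i ∈ Icc 1 (p - 1), ((k * p + i : ℕ) : ℤ)))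
    (hrefl : (∏ k ∈ range c, ∏ i ∈ Icc 1 (p - 1), (C (p : ℤ) * X + C ((k * p + i : ℕ) : ℤ))).eval (-(c : ℤ)) =
      ∏ k ∈ range c, ∏ i ∈ Icc 1 (p - 1), ((k * p + i : ℕ) : ℤ)) :
    ∃ H : ℤ[X], ∏ k ∈ range c, ∏ i ∈ Icc 1 (p - 1), (C (p : ℤ) * X + C ((k * p + i : ℕ) : ℤ)) =
      C (∏ k ∈ range c, ∏ i ∈ Icc 1 (p - 1), ((k * p + i : ℕ) : ℤ)) +
        C ((p : ℤ) ^ M) * X * (X + C (c : ℤ)) * H := by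
  -- adapted from the tree's `Jacobsthal.exists_blocks_eq`
  set E : ℤ[X] := ∏ k ∈ range c, ∏ i ∈ Icc 1 (p - 1), (C (p : ℤ) * X + C ((k * p + i : ℕ) : ℤ)) with hE
  set Q : ℤ := ∏ k ∈ range c, ∏ i ∈ Icc 1 (p - 1), ((k * p + i : ℕ) : ℤ) with hQ
  have hroot0 : (E - C Q).eval 0 = 0 := by rw [eval_sub, eval_C, hE, eval_zero_blocks, sub_self]
  have hrootc : (E - C Q).eval (-(c : ℤ)) = 0 := by rw [eval_sub, eval_C, hrefl, sub_self]
  obtain ⟨G, hG⟩ : X ∣ E - C Q := by rw [X_dvd_iff, coeff_zero_eq_eval_zero, hroot0]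
  have hGc : G.IsRoot (-(c : ℤ)) := by
    have h := hrootc
    rw [hG, eval_mul, eval_X, mul_eq_zero] at h
    rcases h with h | h
    · exfalso; have : (c : ℤ) ≠ 0 := by exact_mod_cast hc.ne'
      exact this (neg_eq_zero.mp h)
    · exact h
  obtain ⟨H₁, hH₁⟩ := dvd_iff_isRoot.mpr hGc
  rw [C_neg, sub_neg_eq_add] at hH₁
  rw [hH₁, ← mul_assoc] at hG
  rw [hG] at hdvd
  obtain ⟨H, hH⟩ := C_dvd_of_C_dvd_X_mul (p ^ M) (c : ℤ) H₁ (by exact_mod_cast hdvd)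
  refine ⟨H, ?_⟩
  rw [← sub_eq_iff_eq_add', hG, hH]
  push_cast
  ring

/-- **The block polynomial congruence with its two roots, odd `p`.** For an odd prime `p` and `c ≥ 0`:
`∏_{k<c} ∏_{0<i<p} (p x + k p + i) = ∏∏ (k p + i) + p^{2+v_p(c)} · x (x + c) · H(x)` for an integer polynomial `H`
— i.e. `∏_{0<i<cp, p∤i} (1 + p x/i) − 1 ∈ p^{2+v_p(c)} x (x + c) ℤ_{(p)}[x]`; evaluated at `x = b` it is
[Straub2014] (41) at `p = 3` in ratio form (next file). One power weaker than the tree's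
`Jacobsthal.exists_blocks_eq` (`p ≥ 5`). [cite: Straub2014, Lemma 5.1 (41) (the case p = 3)] -/
theorem exists_blocks_eq_odd (hp2 : p ≠ 2) (c : ℕ) :
    ∃ H : ℤ[X], ∏ k ∈ range c, ∏ i ∈ Icc 1 (p - 1), (C (p : ℤ) * X + C ((k * p + i : ℕ) : ℤ)) =
      C (∏ k ∈ range c, ∏ i ∈ Icc 1 (p - 1), ((k * p + i : ℕ) : ℤ)) +
        C ((p : ℤ) ^ (padicValNat p c + 2)) * X * (X + C (c : ℤ)) * H := by
  have hp' := hp.out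
  rcases Nat.eq_zero_or_pos c with h0 | hc
  · subst h0; exact ⟨0, by simp⟩
  set s := padicValNat p c with hs
  have hcu : p ^ s * (c / p ^ s) = c := Nat.mul_div_cancel' pow_padicValNat_dvd
  have hone := exists_prod_C_mul_X_add_C_eq_odd (p := p) hp2 (a := s + 1) (by omega)
  have hdvd := C_pow_dvd_blocks_sub_C (p := p) s 1 hone (c / p ^ s)
  rw [hcu, show s + 1 + 1 = padicValNat p c + 2 by omega] at hdvd
  refine exists_blocks_eq_of_dvd (p := p) hc _ hdvd ?_
  rw [eval_neg_blocks_eq, ((hp'.even_sub_one hp2).mul_right c).neg_one_pow, one_mul]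

end Blocks

/-! ### The prime `2`, even `c` -/

section Two

/-- **The block polynomial congruence with its two roots, `p = 2`, `c` even.** For even `c`:
`∏_{k<c} (2x + 2k + 1) = ∏_{k<c} (2k + 1) + 2^{1+v_2(c)} · x (x + c) · H(x)` for an integer polynomial `H`
(written with the inner block `∏_{0<i<2}`), i.e. `∏_{0<i<2c, i odd} (1 + 2x/i) − 1 ∈ 2^{1+v_2(c)} x (x+c) ℤ_{(2)}[x]`
— evaluated at `x = b` it is [Straub2014] (41) at `p = 2` for `a ≡ b (mod 2)` (then `ε = 1`).
[cite: Straub2014, Lemma 5.1 (41) (the case p = 2)] -/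
theorem exists_blocks_eq_two {c : ℕ} (hce : Even c) :
    ∃ H : ℤ[X], ∏ k ∈ range c, ∏ i ∈ Icc 1 (2 - 1), (C (2 : ℤ) * X + C ((k * 2 + i : ℕ) : ℤ)) =
      C (∏ k ∈ range c, ∏ i ∈ Icc 1 (2 - 1), ((k * 2 + i : ℕ) : ℤ)) +
        C ((2 : ℤ) ^ (padicValNat 2 c + 1)) * X * (X + C (c : ℤ)) * H := by
  rcases Nat.eq_zero_or_pos c with h0 | hc
  · subst h0; exact ⟨0, by simp⟩
  set s := padicValNat 2 c with hs
  have hs1 : 1 ≤ s := by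
    rw [hs]
    exact (padicValNat_dvd_iff_le hc.ne').mp (by simpa using hce.two_dvd)
  have hcu : 2 ^ s * (c / 2 ^ s) = c := Nat.mul_div_cancel' pow_padicValNat_dvd
  have hone' := exists_prod_C_mul_X_add_C_eq_two (a := s + 1) (by omega)
  have hone : ∃ H : ℤ[X], ∏ t ∈ {t ∈ range (2 ^ (s + 1)) | (2 ^ (s + 1)).Coprime t},
      (C ((2 : ℕ) : ℤ) * X + C (t : ℤ)) =
      C (∏ t ∈ {t ∈ range (2 ^ (s + 1)) | (2 ^ (s + 1)).Coprime t}, (t : ℤ)) +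
        C (((2 : ℕ) : ℤ) ^ (s + 1 + 0)) * H := by
    simpa using hone'
  have hdvd := C_pow_dvd_blocks_sub_C (p := 2) s 0 hone (c / 2 ^ s)
  rw [hcu, show s + 1 + 0 = padicValNat 2 c + 1 by omega] at hdvd
  refine exists_blocks_eq_of_dvd (p := 2) hc _ (by exact_mod_cast hdvd) ?_
  have h := eval_neg_blocks_eq (p := 2) c
  rw [show (2 - 1) * c = c by omega, hce.neg_one_pow, one_mul] at h
  exact_mod_cast h

end Two

end Literature.NumberTheory.Congruences.JacobsthalWeak

end
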